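import Summits.QuantumAdvantage.QuantumAdvantage.Theorems.CharDialSchedCounterSubcube
import HarnessLib
import Summits.QuantumAdvantage.QuantumAdvantage.Theorems.CharDialFutureReadA

/-!
# E4 — ONE-STEP ADAPTIVE counter strategies on subcubes («twisted R13»; decomp-qadv lens-6 g14, tree part 27)

The 12p-state process of `CounterProcess` / part 24 (`CharDialSchedCounterSubcube`: register `V₄`, hidden label `ℤ/3`,
counter `ℤ/p`) with the most general ONE-STEP ADAPTIVE step: at step `t`, on the BRANCH `β = u_t ∈ {0,1}` (the value of the bit
consumed at step `t`), the register is translated FIBRE-WISE by a label-to-register map `a ↦ v t β b a` that is ADMISSIBLE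
(`∈ Adm`: of the form `a ↦ τ ⊕ [σ]·e(a + d) = admV (τ, σ, d) a`; `e c = tog c 0`), then `(a, b) ↦ (a + 1 + β, b + β)`; a final
fibre-wise admissible fire `vf` follows the last bit.  This contains R13 (pure counter fires `σ = A_t(b)`, `τ = 0`, `d = 0` on
both branches), R13⊕ = part 24 (branch 1 additionally `⊕ τ_t`), and — NEW — LOOKAHEAD-ONE reads `y_t = h_t(b_t, u_t)`
(`σ = h_t(b, β)`), MEMORY-ONE reads `y_{t+1} = h(b_{t+1}, u_t)` re-timed to step `t` (`σ = h(b + β, β)`, `d = 1 + β`: a SHIFTED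
tog), fibre-dependent aliens, and every `⊕`-combination (`admV_bx`).
THEOREM `adaptiveSubcube_sharp` (`3 ∤ p`): on the subcube `{u_W = b_W}` with `m = n − |W|` free positions, for every column `κ`
the final `(register, label)` lies outside the LOSE member `L_{(κ,0)}` for at most `(2/3 + 5p·√(12p/(m+1)))·2ⁿ` merged inputs.
PROOF = part 24's six steps with two new ingredients: (i) `Φ` is invariant under EVERY fibre-wise admissible fire (`phi_fireA`:
`admV π` induces the label-independent permutation `admIdx π` of `𝓛`, `mem_admIdx`, decided), so `Φ` is monotone along the
process (`phi_lawA_mono`) and the `L²` budget runs w.r.t. the TWISTED shift `RA t = F⁰ ∘ shK 1 ∘ F¹` (`Q_lawA_succ_free`);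
(ii) the floor WITHOUT label averaging: the return map of `(RA t)⁻¹` to a counter fibre after `p` steps is
`(g, a) ↦ (g ⊕ c_b(a), a − p)` with `c_b` ADMISSIBLE (`nS_adm`), and the decided **twisted two-block lemma** (`twisted_two_block`:
along six iterates of such a map every member of `𝓛` is met at least twice) gives
`Φ(μ) ≥ (Σ μ)/3 − (5p/2)·‖μ − μ∘(RA t)⁻¹‖₁` for every nonnegative law (`phi_ge_third_twist`) — replacing `phi_ge_third` + `l1_lam_le_T`.
WHY (E4, NODE-g14 / E4-BLUEPRINT.md): bits read AT or NEXT TO their consumption time act on the walk's register by admissible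
branch-dependent translations; with parts 25/26 (E3, E3ʳ) and the reduction of blueprint §5 (part 28) this closes the one-read
prefix face.  WHAT THIS IS NOT: reads of two free FUTURE bits by one cut (degree-2 promises) are not one-step adaptive.
Kernel-closed (propext, Classical.choice, Quot.sound); imports part 24 only.
-/

namespace Summit.QuantumAdvantage.AdviceFreeQNC0

open Finset AffBells22

namespace CounterLaw

/-! ## §1 Admissible label-to-register maps and their action on `𝓛` -/

section Adm

/-- parameters `(τ, σ, d)` of an admissible label-to-register map `a ↦ τ ⊕ [σ]·e(a + d)`. -/
abbrev AdmP := (Bool × Bool) × Bool × ZMod 3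

/-- the admissible map with parameters `π = (τ, σ, d)`. -/
def admV (π : AdmP) (a : ZMod 3) : Bool × Bool :=
  if π.2.1 then bx π.1 (tog (a + π.2.2) (false, false)) else π.1

/-- `bx s s = 0`. -/
theorem bxA_self (s : Bool × Bool) : bx s s = (false, false) := by
  rcases s with ⟨a, b⟩; simp [bx]

set_option maxHeartbeats 4000000 in
/-- admissible maps form a group under pointwise `⊕` … -/
theorem admV_bx (π π' : AdmP) : ∃ π'' : AdmP, ∀ a, bx (admV π a) (admV π' a) = admV π'' a := by
  revert π π'; decide

set_option maxHeartbeats 4000000 in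
/-- … stable under label pre-shifts. -/
theorem admV_shift (π : AdmP) (s : ZMod 3) : ∃ π' : AdmP, ∀ a, admV π (a + s) = admV π' a := by
  revert π s; decide

/-- the zero map is admissible. -/
theorem admV_zero (a : ZMod 3) : admV ((false, false), false, 0) a = (false, false) := by
  revert a; decide

/-- xoring the register by a vector with evaluation pattern `1 − δ_c'`: the index moves by the pattern point `c`. -/
def idxPt (c : ZMod 3) (i : Idx) : Idx :=
  match i.2 with
  | none => (i.1, some c)
  | some r => if r = c then (i.1, none) else (i.1, some (2 * r + 2 * c))

/-- the label `a'` with `e a' = τ` for a nonzero alien vector `τ`. -/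
def alienPt (τ : Bool × Bool) : ZMod 3 :=
  if τ = (true, true) then 2 else if τ = (false, true) then 0 else 1

/-- the permutation of `Idx` induced by the admissible map `π`: `(g ⊕ admV π a, a) ∈ L_i ⟺ (g, a) ∈ L_{admIdx π i}`. -/
def admIdx (π : AdmP) (i : Idx) : Idx :=
  if π.2.1 then
    idxPt (2 * i.1 - 2 * π.2.2) (if π.1 = (false, false) then i else idxPt (i.1 - alienPt π.1) i)
  else (if π.1 = (false, false) then i else idxPt (i.1 - alienPt π.1) i)

set_option maxHeartbeats 4000000 in
/-- **admissible maps act on `𝓛`** by a LABEL-INDEPENDENT permutation of the indices. -/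
theorem mem_admIdx (π : AdmP) (i : Idx) (g : Bool × Bool) (a : ZMod 3) :
    mem (admIdx π i) g a = mem i (bx g (admV π a)) a := by
  revert π i g a; decide

set_option maxHeartbeats 4000000 in
/-- `admIdx π` is injective … -/
theorem admIdx_inj (π : AdmP) (i j : Idx) (h : admIdx π i = admIdx π j) : i = j := by
  revert π i j; decide

/-- … hence a permutation of `Idx`. -/
noncomputable def admEquiv (π : AdmP) : Idx ≃ Idx :=
  Equiv.ofBijective (admIdx π) (Finite.injective_iff_bijective.mp fun i j h => admIdx_inj π i j h)

/-- the set of ADMISSIBLE label-to-register maps `a ↦ τ ⊕ [σ]·e(a + d)` (`= admV (τ, σ, d)`). -/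
def Adm : Set (ZMod 3 → Bool × Bool) := Set.range admV

/-- CharDialAdaptiveCounterSubcube helper `mem_Adm`. -/
theorem mem_Adm {f : ZMod 3 → Bool × Bool} : f ∈ Adm ↔ ∃ π : AdmP, ∀ a, f a = admV π a := by
  constructor
  · rintro ⟨π, h⟩; exact ⟨π, fun a => (congrFun h a).symm⟩
  · rintro ⟨π, h⟩; exact ⟨π, funext fun a => (h a).symm⟩

/-- CharDialAdaptiveCounterSubcube helper `admV_mem_Adm`. -/
theorem admV_mem_Adm (π : AdmP) : admV π ∈ Adm := ⟨π, rfl⟩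

/-- admissible maps are closed under pointwise `⊕` … -/
theorem bx_mem_Adm {f g : ZMod 3 → Bool × Bool} (hf : f ∈ Adm) (hg : g ∈ Adm) : (fun a => bx (f a) (g a)) ∈ Adm := by
  obtain ⟨π, hπ⟩ := mem_Adm.1 hf
  obtain ⟨π', hπ'⟩ := mem_Adm.1 hg
  obtain ⟨π'', h⟩ := admV_bx π π'
  exact mem_Adm.2 ⟨π'', fun a => by simp only [hπ, hπ', h]⟩

/-- … and under label pre-shifts. -/
theorem shift_mem_Adm {f : ZMod 3 → Bool × Bool} (hf : f ∈ Adm) (s : ZMod 3) : (fun a => f (a + s)) ∈ Adm := by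
  obtain ⟨π, hπ⟩ := mem_Adm.1 hf
  obtain ⟨π', h⟩ := admV_shift π s
  exact mem_Adm.2 ⟨π', fun a => by simp only [hπ, h]⟩

/-- constants are admissible (`σ = 0`) … -/
theorem const_mem_Adm (τ : Bool × Bool) : (fun _ => τ) ∈ Adm := mem_Adm.2 ⟨(τ, false, 0), fun a => by simp [admV]⟩

/-- … and so are the optional shifted togs `[σ]·e(a + d)`. -/
theorem tog_mem_Adm (σ : Bool) (d : ZMod 3) :
    (fun a => if σ = true then tog (a + d) (false, false) else (false, false)) ∈ Adm :=
  mem_Adm.2 ⟨((false, false), σ, d), fun a => by cases σ <;> simp [admV, bx]⟩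

/-- case splits of admissible maps on a label-independent condition are admissible. -/
theorem ite_mem_Adm {f g : ZMod 3 → Bool × Bool} (hf : f ∈ Adm) (hg : g ∈ Adm) (c : Prop) [Decidable c] :
    (fun a => if c then f a else g a) ∈ Adm := by
  by_cases hc : c
  · simp only [if_pos hc]; exact hf
  · simp only [if_neg hc]; exact hg

variable (p : ℕ)

/-- a FIBRE-WISE FIRE: in counter fibre `b` the register is translated by `w b a` (an equivalence for every `w`; `Φ`-preserving
when every `w b` is ADMISSIBLE, `phi_fireA`). -/
def fireA (w : ZMod p → ZMod 3 → Bool × Bool) : St p ≃ St p where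
  toFun x := (bx x.1 (w x.2.2 x.2.1), x.2.1, x.2.2)
  invFun x := (bx x.1 (w x.2.2 x.2.1), x.2.1, x.2.2)
  left_inv x := by simp [bx_bx]
  right_inv x := by simp [bx_bx]

/-- CharDialAdaptiveCounterSubcube helper `fireA_apply`. -/
theorem fireA_apply (w : ZMod p → ZMod 3 → Bool × Bool) (x : St p) : fireA p w x = (bx x.1 (w x.2.2 x.2.1), x.2.1, x.2.2) := rfl

/-- CharDialAdaptiveCounterSubcube helper `fireA_symm_apply`. -/
theorem fireA_symm_apply (w : ZMod p → ZMod 3 → Bool × Bool) (x : St p) :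
    (fireA p w).symm x = (bx x.1 (w x.2.2 x.2.1), x.2.1, x.2.2) := rfl

/-- a fibre-wise admissible fire is an involution. -/
theorem fireA_fireA (w : ZMod p → ZMod 3 → Bool × Bool) (x : St p) : fireA p w (fireA p w x) = x := by
  simp [fireA_apply, bx_bx]

variable {p}

/-- admissible-fire invariance of the masses (per fibre, up to the permutation `admIdx`). -/
theorem mass_fireA (μ : St p → ℝ) (w : ZMod p → ZMod 3 → Bool × Bool) (i : Idx) (b : ZMod p) (π : AdmP)
    (hπ : ∀ a, w b a = admV π a) :
    mass (fun x => μ (fireA p w x)) i b = mass μ (admIdx π i) b := by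
  unfold mass
  refine sum_comm.trans ((sum_congr rfl fun a _ => ?_).trans sum_comm)
  rw [← Equiv.sum_comp (Function.Involutive.toPerm (fun g => bx g (admV π a)) (fun g => bx_bx g _))
    (fun g => if mem (admIdx π i) g a = true then μ (g, a, b) else 0)]
  refine sum_congr rfl fun g _ => ?_
  simp only [Function.Involutive.coe_toPerm, mem_admIdx, bx_bx, fireA_apply, hπ]

/-- **`Φ` is invariant under EVERY fibre-wise admissible fire.** -/
theorem phi_fireA [NeZero p] (μ : St p → ℝ) (w : ZMod p → ZMod 3 → Bool × Bool) (hw : ∀ b, w b ∈ Adm) :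
    phi (fun x => μ (fireA p w x)) = phi μ := by
  unfold phi
  refine sum_congr rfl fun b _ => ?_
  obtain ⟨π, hπ⟩ := mem_Adm.1 (hw b)
  simp only [mass_fireA μ w _ b π hπ]
  exact inf'_comp_equiv ⟨(0, none), mem_univ _⟩ (admEquiv π) (fun i => mass μ i b)

end Adm

/-! ## §2 The twisted two-block lemma (finite, decided) -/

section Twist

/-- the return map of a twisted shift to a counter fibre: `T (g, a) = (g ⊕ admV π a, a + q)`. -/
def retT (π : AdmP) (q : ZMod 3) (x : (Bool × Bool) × ZMod 3) : (Bool × Bool) × ZMod 3 :=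
  (bx x.1 (admV π x.2), x.2 + q)

set_option maxHeartbeats 4000000 in
/-- label increment `q = 1`: along six iterates every member of `𝓛` is met at least twice. -/
theorem twisted_two_block_one (π : AdmP) (x : (Bool × Bool) × ZMod 3) (i : Idx) :
    2 ≤ ((range 6).filter fun k => mem i ((retT π 1)^[k] x).1 ((retT π 1)^[k] x).2 = true).card := by
  revert π x i; decide

set_option maxHeartbeats 4000000 in
/-- label increment `q = 2`. -/
theorem twisted_two_block_two (π : AdmP) (x : (Bool × Bool) × ZMod 3) (i : Idx) :
    2 ≤ ((range 6).filter fun k => mem i ((retT π 2)^[k] x).1 ((retT π 2)^[k] x).2 = true).card := by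
  revert π x i; decide

/-- **THE TWISTED TWO-BLOCK LEMMA**: for an admissible twist and a label increment `q ≠ 0`, along six iterates of the return
map every member of `𝓛` is met at least twice (the untwisted `π = 0` case is R13's `exists_mem_idx`). -/
theorem twisted_two_block (π : AdmP) (q : ZMod 3) (hq : q ≠ 0) (x : (Bool × Bool) × ZMod 3) (i : Idx) :
    2 ≤ ((range 6).filter fun k => mem i ((retT π q)^[k] x).1 ((retT π q)^[k] x).2 = true).card := by
  have hq' : q = 1 ∨ q = 2 := by revert q; decide
  rcases hq' with rfl | rfl
  · exact twisted_two_block_one π x i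
  · exact twisted_two_block_two π x i

end Twist

/-! ## §3 The adaptive process -/

section Process

variable {n : ℕ} (p : ℕ) (v : ℕ → Bool → ZMod p → ZMod 3 → Bool × Bool)

/-- the register before step `t`: step `s < t` translated it by `v s u_s b_s a_s`. -/
def regA (u : Fin n → Bool) : ℕ → Bool × Bool
  | 0 => (false, false)
  | t + 1 => if h : t < n then bx (regA u t) (v t (u ⟨t, h⟩) (ctrN p u t) (labN u t)) else regA u t

/-- the state `(register, label, counter)` before step `t`. -/
def XA (u : Fin n → Bool) (t : ℕ) : St p := (regA p v u t, labN u t, ctrN p u t)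

/-- CharDialAdaptiveCounterSubcube helper `XA_zero`. -/
theorem XA_zero (u : Fin n → Bool) : XA p v u 0 = ((false, false), 0, 0) := by
  have h := X_zero p (fun _ _ => false) u
  simp only [X, Prod.mk.injEq] at h
  refine Prod.ext rfl (Prod.ext h.2.1 h.2.2)

/-- **the adaptive step**: `XA u (t+1) = bitEq (u t) (fireA (v t (u t)) (XA u t))`. -/
theorem XA_succ (u : Fin n → Bool) (t : Fin n) :
    XA p v u (t.val + 1) = bitEq p (u t) (fireA p (v t.val (u t)) (XA p v u t.val)) := by
  have h := X_succ p (fun _ _ => false) u t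
  simp only [X, Xp, bitEq_apply, Prod.mk.injEq] at h
  refine Prod.ext ?_ (Prod.ext h.2.1 h.2.2)
  simp only [XA, fireA_apply, bitEq_apply, regA, dif_pos t.isLt, Fin.eta]

/-- adaptedness of the register: `regA u t` reads only bits `< t`. -/
theorem regA_update (u : Fin n → Bool) (i : Fin n) (β : Bool) : ∀ {t : ℕ}, t ≤ i.val →
    regA p v (Function.update u i β) t = regA p v u t
  | 0, _ => rfl
  | t + 1, ht => by
    have ht' : t ≤ i.val := by omega
    have hti : t < n := by omega
    have hne : (⟨t, hti⟩ : Fin n) ≠ i := fun h => by rw [Fin.ext_iff] at h; simp at h; omega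
    simp only [regA, dif_pos hti, ctrN, labN, wtPrefix_update_of_le u i β ht', regA_update u i β ht',
      Function.update_of_ne hne]

/-- **adaptedness**: the state before step `t` reads only bits `< t`. -/
theorem XA_update (u : Fin n → Bool) (i : Fin n) (β : Bool) {t : ℕ} (ht : t ≤ i.val) :
    XA p v (Function.update u i β) t = XA p v u t := by
  simp only [XA, labN, ctrN, wtPrefix_update_of_le u i β ht, regA_update p v u i β ht]

end Process

/-! ## §4 Laws on a subcube and their recursion -/

section SubProcess

variable {n : ℕ} (p : ℕ) (v : ℕ → Bool → ZMod p → ZMod 3 → Bool × Bool) (W : Finset (Fin n)) (b : Fin n → Bool)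

/-- law of the state before step `t` over the subcube (each point counted `2^{|W|}` times). -/
noncomputable def lawA (t : ℕ) (x : St p) : ℝ :=
  ((univ.filter fun u : Fin n → Bool => XA p v (subcubeMerge W b u) t = x).card : ℝ)

/-- CharDialAdaptiveCounterSubcube helper `lawA_nonneg`. -/
theorem lawA_nonneg (t : ℕ) (x : St p) : 0 ≤ lawA p v W b t x := Nat.cast_nonneg _

/-- **adaptive free step**: at `t ∉ W` the law is the average of the two branch bijections `bitEq β ∘ fireA (v t β)`. -/
theorem lawA_succ_free (t : Fin n) (ht : t ∉ W) (x : St p) :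
    lawA p v W b (t.val + 1) x
      = (lawA p v W b t.val ((fireA p (v t.val false)).symm ((bitEq p false).symm x))
          + lawA p v W b t.val ((fireA p (v t.val true)).symm ((bitEq p true).symm x))) / 2 := by
  have hm : ∀ u : Fin n → Bool, subcubeMerge W b u t = u t := fun u => merge_apply_free W b u ht
  have hsplit : (univ.filter fun u : Fin n → Bool => XA p v (subcubeMerge W b u) (t.val + 1) = x)
      = (univ.filter fun u : Fin n → Bool =>
            u t = false ∧ XA p v (subcubeMerge W b u) t.val = (fireA p (v t.val false)).symm ((bitEq p false).symm x)) ∪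
        (univ.filter fun u : Fin n → Bool =>
            u t = true ∧ XA p v (subcubeMerge W b u) t.val = (fireA p (v t.val true)).symm ((bitEq p true).symm x)) := by
    ext u
    simp only [mem_filter, mem_univ, true_and, mem_union, XA_succ, Equiv.eq_symm_apply, hm]
    cases u t
    · simp
    · simp
  have hdisj : Disjoint
      (univ.filter fun u : Fin n → Bool =>
        u t = false ∧ XA p v (subcubeMerge W b u) t.val = (fireA p (v t.val false)).symm ((bitEq p false).symm x))
      (univ.filter fun u : Fin n → Bool =>
        u t = true ∧ XA p v (subcubeMerge W b u) t.val = (fireA p (v t.val true)).symm ((bitEq p true).symm x)) := by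
    rw [disjoint_filter]
    rintro u _ ⟨h1, _⟩ ⟨h2, _⟩
    rw [h1] at h2; exact Bool.false_ne_true h2
  unfold lawA
  rw [hsplit, card_union_of_disjoint hdisj, Nat.cast_add,
    card_filter_bit_eq_half t false _
      (fun u b' => by rw [merge_update_free W b u ht, XA_update p v _ t b' le_rfl]),
    card_filter_bit_eq_half t true _
      (fun u b' => by rw [merge_update_free W b u ht, XA_update p v _ t b' le_rfl])]
  ring

/-- **frozen step**: at `t ∈ W` the law moves by the bijection `bitEq (b t) ∘ fireA (v t (b t))`. -/
theorem lawA_succ_frozen (t : Fin n) (ht : t ∈ W) (x : St p) :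
    lawA p v W b (t.val + 1) x
      = lawA p v W b t.val ((fireA p (v t.val (b t))).symm ((bitEq p (b t)).symm x)) := by
  have hm : ∀ u : Fin n → Bool, subcubeMerge W b u t = b t := fun u => merge_apply_frozen W b u ht
  unfold lawA
  congr 2
  ext u
  simp only [mem_filter, mem_univ, true_and, XA_succ, Equiv.eq_symm_apply, hm]

/-- the initial law is the point mass `2ⁿ·δ_{(0,0,0)}`. -/
theorem lawA_zero (x : St p) : lawA p v W b 0 x = if x = ((false, false), 0, 0) then 2 ^ n else 0 := by
  unfold lawA
  simp only [XA_zero]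
  by_cases hx : x = ((false, false), 0, 0)
  · rw [if_pos hx]; subst hx; simp
  · rw [if_neg hx]
    simp [Ne.symm hx]

variable [NeZero p]

/-- CharDialAdaptiveCounterSubcube helper `sum_lawA`. -/
theorem sum_lawA (t : ℕ) : ∑ x, lawA p v W b t x = 2 ^ n := by
  unfold lawA
  rw [← Nat.cast_sum, ← card_eq_sum_card_fiberwise (s := univ) (t := univ)
    (fun u _ => mem_univ (XA p v (subcubeMerge W b u) t))]
  simp

/-- the count of merged inputs whose FINAL-FIRED `(register, label)` lies in `L_{i₀}`, as a mass of the law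
`lawA n ∘ fireA vf`. -/
theorem card_memA_eq (vf : ZMod p → ZMod 3 → Bool × Bool) (i₀ : Idx) :
    ((univ.filter fun u : Fin n → Bool =>
        mem i₀ (fireA p vf (XA p v (subcubeMerge W b u) n)).1 (fireA p vf (XA p v (subcubeMerge W b u) n)).2.1 = true).card : ℝ)
      = ∑ b' : ZMod p, mass (fun x => lawA p v W b n (fireA p vf x)) i₀ b' := by
  rw [card_eq_sum_card_fiberwise (t := univ) (f := fun u => fireA p vf (XA p v (subcubeMerge W b u) n))
    (fun u _ => mem_univ _), Nat.cast_sum, sum_St]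
  refine sum_congr rfl fun b' _ => ?_
  unfold mass lawA
  refine sum_congr rfl fun g _ => sum_congr rfl fun a _ => ?_
  by_cases hmm : mem i₀ g a = true
  · rw [if_pos hmm]
    congr 2; ext u
    simp only [mem_filter, mem_univ, true_and]
    constructor
    · exact fun h => by rw [← h.2, fireA_fireA]
    · intro h
      have h' : fireA p vf (XA p v (subcubeMerge W b u) n) = (g, a, b') := by
        rw [h, fireA_fireA]
      refine ⟨?_, h'⟩; rw [h']; exact hmm
  · rw [if_neg hmm]
    norm_cast
    rw [card_eq_zero, filter_eq_empty_iff]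
    rintro u hu h
    simp only [mem_filter, mem_univ, true_and] at hu
    rw [h] at hu; exact hmm hu

end SubProcess

end CounterLaw
end Summit.QuantumAdvantage.AdviceFreeQNC0
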